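/-
COR-CM (cell pub-hodgecm2, stage 2 of the Hodge ladder) — Δ2 BRIDGE, the (c)+(d) residual of the END BY VALUE at the re-key (c-S.1):
the J-record `M ∕ jH ∕ hjHinj ∕ hjH` AND the pieces `pieces K hK` as ONE existential, with the J2 interface `J` and its instance `ῑ₁`
INTERNALISED, over the SHARED `ι₁`-presented tail of record (seat prover-pub-hodgecm2-d2bridge-prove-3-g3-0, d2bridge-prove-3).
THEOREMS ONLY (kernel lane): no definition, no instance, no named fact, no `sorry`; nothing landed is edited or restated; OUTSIDE the
port manifest (blanket `CorCM/D2Bridge/*`).  FRAMING: HC_CM is NOT proved; «Δ2 BRIDGE CLOSED» is NOT claimed; HELD pending the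
orientation re-key; no pointer ∕ count ∕ hM token.
-/
import Summits.HodgeConjecture.CorCM.D2Bridge.HcmPiecesAtPinConjInst
import Summits.HodgeConjecture.CorCM.D2Bridge.ComponentAlbanesePinLaw
import Literature.NumberTheory.Automorphic.Liu2021.Def45RMuFormSupply
import HarnessLib

set_option autoImplicit false

/-!
# Δ2 bridge, (c)+(d) BY VALUE: the J-record and the pieces as one existential, instance `ῑ₁` internalised, tail of record at `ι₁`

[Liu2021] Y. Liu, *Fourier–Jacobi cycles and arithmetic relative trace formula*, Camb. J. Math. **9** (2021) = arXiv:2102.11518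
(`l. NNNN` = lines of the author's TeX `FJcycle.tex`).

The END (`CorCM/PortJoin/ClosedPrinted.lean`, and its re-keyed twin) displays the (c)(d) half of the Δ2 bridge BY NAME
(RESIDUAL-SHORT): binders `M i μ hμ hw hΦμ : (toThm418Data ℭ ((𝕌 i).rest 𝔱⟦μ⟧)).Map43RationalData`, `jH`, `hjHinj`, `hjH`, and
`pieces … K hK : HcmPieces … (M …) (𝔇).H (jH …) K.K (H¹(P_K; ℂ)) (resTotal K) ((𝔇).cmClasses K i)`, where the tail of record
`𝔱⟦μ⟧ = restTailOne (AlgHom.id ℚ F) ι₁ hμ hw (ofPolDR μ (PolDR ι₁ hμ (RMuForm ι₁ hμ))) (𝒯.rhoΩOne …)` is PRESENTED THROUGH `ι₁`.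
The tree's surfaces and the J2 interface `J : ComponentAlbanese …` (✔ `componentAlbanesePinTotal`) live under the GEOMETRIC instance
`algebraMap L ℂ = ῑ₁ := conj ∘ ι₁`; the S1 junction that reads the `ι₁`-presented datum through that instance is wb-2's
✔ `exists_dLiu_of_objOne_conj` (admissibility output `IsReflexOfTypeG ῑ₁ Φ_μ`), and the dictionary RE-KEYED at `ῑ₁`
(`HodgeCM.Model.Rekey.liuDictionaryPin`, `adm′ i d := d.IsReflexOfTypeG ῑ₁ (typeOfLine (line i))`) accepts that output through the
T-SIGN = MIRROR identity `Φ_μ = typeOfLine (line i)` alone.  This file packages the whole (c)(d) half for such a consumer: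

* §1 `exists_jRecord_pieces_conj` — THE PLUG: at App. C's total carrier `Model.sec42DataOf h iso (pkgF L) ι₁ (pkgV V) Φ` with its Hecke
  translates `Model.sec42DataOf_heckeTranslates hU7 h (pkgV V) Φ iso h4` (the END's `ℭ ∕ 𝒯`), for ANY `U : UniformOmega ℭ`, ANY one object
  `Dμ` presented through `ι₁`, ANY `τ' ∈ Φ_μ`:  `∃ M jH, Injective jH ∧ (jH equivariant) ∧ ∀ K ≤ Level.capThree K₀, Nonempty (HcmPieces …)`
  — the instance `ῑ₁.toAlgebra`, `J := componentAlbanesePinTotal …` and its level law (✔ `componentAlbanesePinTotal_levelLaw`, d2bridge-prove-5)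
  are INTERNAL, so the statement mentions no `Algebra L ℂ` at all and a consumer obtains the five END binders by `choose`;
  `exists_jRecord_pieces_conj_of_casselman` — the same with `Dμ` DISCHARGED at the carrier of record `ofPolDR μ (PolDR ι₁ hμ (RMuForm ι₁ hμ))`
  by the END's own cite `h21` = [Shimura1998] Thm. 21.4 (✔ `Def45.nonempty_cmDatum_polDR_rMuForm_of_casselman`) and `τ' ∈ Φ_μ` chosen inside.
  The (d) half is d2bridge-wb-3's ✔ `nonempty_hcmPieces_atUniformRest_conjInst` (`HcmPiecesAtPinConjInst.lean`: this seat's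
  ✔ `nonempty_hcmPieces_atJRecordPin` with the S1 step read through the instance `ῑ₁` on the `ι₁`-presented datum); the (c) half is
  d2bridge-prove-2's ✔ `map43RecordAtPin ∕ jHPin ∕ jHPin_injective ∕ jHPin_comm` at d2bridge-prove-5's `J`.
* §2 `exists_jRecord_pieces_rekeyedPin` — §1 at the RE-KEYED LITERAL PIN's carriers (`Char := I`, `Adm i := {χ ∕∕ (line i).IsAutChar χ}`,
  `Ω i a := (line i).Ω (ιVE V) a.1`, `PhiMu′ i := PhiMuLine ῑ₁ (line i)`, `adm′ i d := d.IsReflexOfTypeG ῑ₁ (typeOfLine (line i))` — the body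
  of `HodgeCM.Model.Rekey.liuDictionaryPin`, an `abbrev` chain over `LiuDictionary.ofTower`), tail spelled with the END's
  `heckeTranslatesFamilyOf hU7 h iso … h6`, inputs the END's rows `hU7 ∕ h ∕ h6 ∕ h21`, its `U`, and the key `hΦμ : HasCMType L μ (line i).lineType`.

At the re-keyed literal pin (`Char := I`, `Adm i := {χ ∕∕ (line i).IsAutChar χ}`, `Ω i a := (line i).Ω (ιVE V) a.1`,
`PhiMu i := PhiMuLine ῑ₁ (line i)`, `adm i d := d.IsReflexOfTypeG ῑ₁ (typeOfLine (line i))` — all `abbrev`s of `CorCM/Rekey/LiuDictionaryPin.lean`)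
the input `hadmμ` of §1 is `fun d hd => hΦ ▸ hd` for `hΦ : hμ.cmType = (line i).lineType` (`HasCMType.unique hμ.hasCMType_cmType hΦμ`) — §2.
CONSUMER RECIPE (END′ §B): `choose M jH hjHinj hjH hP using fun i μ hμ hw hΦμ => exists_jRecord_pieces_rekeyedPin …` and
`pieces := fun i μ hμ hw hΦμ K hK => Classical.choice (hP i μ hμ hw hΦμ K hK)`.  Nothing about Liu's objects is asserted.  HC_CM is NOT proved; «Δ2 BRIDGE CLOSED» is NOT claimed.

## References
* [Liu2021] Thm. 4.18 (l. 2232–2245) with proof, map (4.2)/(4.3) (l. 2247–2253: «fix τ′ ∈ Φ_μ»); Thm. 4.18 (1) (l. 2239); Rem. 4.17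
  (l. 2226–2228); Lem. 2.4 (1) with proof (l. 1210–1228); Def. 4.3 (2) (l. 1919); Rem. 4.4 (l. 1930–1933); Def. 4.5 (2) (l. 1944–1951);
  Prop. 4.6 (1) (l. 1969); §4.2 l. 2062–2081; App. C Prop. C.5 (l. 4627–4628).
* [Shimura1998] G. Shimura, *Abelian Varieties with Complex Multiplication and Modular Functions* (1998), Thm. 21.4; §8.3 Prop. 28.
* Tree: `CorCM/D2Bridge/{HcmPiecesAtPinConjInst, HcmPiecesAtPin, ConjugateTail, Map43RecordAtPin[Levels], ComponentAlbanese[Pin,PinLaw], HcmS1PinJunction[Conj]}.lean`,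
  `Literature/NumberTheory/Automorphic/Liu2021/{Def45RMuFormSupply, AppendixC/RestOne}.lean`.
-/

noncomputable section

open scoped TensorProduct
open CategoryTheory NumberField Function
open Literature.AlgebraicGeometry.Motives (AbelianVariety bettiCohomology)
open Literature.AlgebraicGeometry.HodgeTheory
open Literature.AlgebraicGeometry.ShimuraVarieties.UnitaryCanonicalModel (exists_recordSystem heckeTranslate_definedOver)
open Literature.NumberTheory.Automorphic Literature.NumberTheory.Automorphic.Liu2021 Literature.NumberTheory.Automorphic.Liu2021.AppendixC
open Literature.NumberTheory.Automorphic.Liu2021.AppendixC.RestOne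
open Literature.NumberTheory.Automorphic.PicardCM
open Literature.NumberTheory.ComplexMultiplication (shimura1998_thm21_4_casselman)
open Literature.NumberTheory.Transcendental (Arapura2012_Cor_15_4_6)
open HodgeCM HodgeCM.Model HodgeCM.Model.LevelTranslate HodgeCM.Model.TowerLevel HodgeCM.Model.TowerCarrier
open Summit.HodgeConjecture.CorCM.D2Bridge.TowerRational
open Summit.HodgeConjecture.CorCM.Model (sec42DataOf sec42DataOf_heckeTranslates)

namespace Summit.HodgeConjecture.CorCM.D2Bridge

/-! ## §1  THE PLUG: (c)+(d) as one existential at App. C's total carrier, `J` and the instance `ῑ₁` internalised -/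

section Plug

open HodgeCM.Literature.Theta.LiuAlbaneseModuleDatum.D2Bridge (HcmPieces)

variable {L : HodgeCM.CMField} [IsGalois ℚ (L : Type)] {ι₁ : L →+* ℂ}
variable (V : HodgeCM.HermSpace3 L ι₁)
variable (Char : Type) (Adm : Char → Type) (Ω : (i : Char) → Adm i → Type)
  [∀ i a, AddCommGroup (Ω i a)] [∀ i a, Module ℂ (Ω i a)] [∀ i a, Module (adelicAlgebra V) (Ω i a)]
  [∀ i a, IsScalarTower ℂ (adelicAlgebra V) (Ω i a)] (PhiMu : Char → Prop) (adm : Char → LiuCMSide → Prop)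
variable {μ : Literature.NumberTheory.Automorphic.IdeleClassGroup L →ₜ* Circle}
  (hμ : Literature.NumberTheory.Automorphic.IdeleClassGroup.IsConjugateSymplectic L μ)
  (hw : Literature.NumberTheory.Automorphic.IdeleClassGroup.HasWeight L μ 1)

set_option synthInstance.maxHeartbeats 400000 in
set_option maxHeartbeats 3200000 in
/-- **(c)+(d) BY VALUE — THE PLUG.**  At App. C's total §4.2 carrier `ℭ := Model.sec42DataOf h iso (pkgF L) ι₁ (pkgV V) Φ` with Hecke
translates `𝒯 := Model.sec42DataOf_heckeTranslates hU7 h (pkgV V) Φ iso h4` (the END's standing datum), for any μ-uniform Weil carriers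
`U : UniformOmega ℭ`, any one object `Dμ ∈ 𝒜(μ)` PRESENTED THROUGH `ι₁` (the tail of record), any `τ' ∈ Φ_μ`, and any dictionary key
`adm i` implied by `IsReflexOfTypeG ῑ₁ Φ_μ` (`ῑ₁ := conj ∘ ι₁`; the re-keyed pin under T-SIGN = MIRROR): THERE ARE a rational (4.3)
record `M` of the Thm-4.18 datum of `U.rest 𝔱⟦μ⟧` and an injective `ℂ[U(V)(𝔸_f)]`-equivariant `jH : M.HB → H` into the tower such that
the pieces `HcmPieces … M H jH K.K (H¹(P_K; ℂ)) (resTotal K) (cmClasses K i)` are inhabited at every level `K ≤ Level.capThree K₀`.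
WITNESSES (all tree terms, the instance `algebraMap L ℂ := ῑ₁` opened INSIDE the proof): `J := componentAlbanesePinTotal …` with its
level law (d2bridge-prove-5 ∕ -2), `M := map43RecordAtPin J (AlgHom.id ℚ L) ι₁ … Dμ τ' hτ'`, `jH := jHPin …` with `jHPin_injective ∕
jHPin_comm` (d2bridge-prove-2), pieces := ✔ `nonempty_hcmPieces_atUniformRest_conjInst` (d2bridge-wb-3).  The statement mentions no `Algebra L ℂ`: a consumer (the END's §A) obtains its five
binders `M ∕ jH ∕ hjHinj ∕ hjH ∕ pieces` by `choose`.  HC_CM is NOT proved; «Δ2 BRIDGE CLOSED» is NOT claimed.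
[cite: Liu2021, Thm. 4.18 (1) (FJcycle.tex l. 2239), Rem. 4.17 (l. 2226–2228), proof of Thm. 4.18 (l. 2247–2253), Lem. 2.4 (1) (l. 1210–1228), Def. 4.3 (2) (l. 1919), Def. 4.5 (2) (l. 1944–1951), §4.2 (l. 2062–2081)] -/
theorem exists_jRecord_pieces_conj (hHD : exists_isReal_hodgeModel) (hI : hodgePQ_independent_of_hodgeModel)
    (h₁ : BallQuotientUniformised) (h₃ : CMAbelianVarietyRealised) (hA : Arapura2012_Cor_15_4_6)
    (hU7 : heckeTranslate_definedOver) {h : exists_recordSystem} (h4 : 4 ≤ Module.finrank ℚ (L : Type))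
    (Φ : Literature.AlgebraicGeometry.Motives.CMType L)
    (iso : ∀ (F : Summit.HodgeConjecture.CorCM.CMField) (ι : F →+* ℂ) (_ : Summit.HodgeConjecture.CorCM.HermSpace3 F ι)
      (_ : Literature.AlgebraicGeometry.Motives.CMType F), ℕ → Prop)
    (U : UniformOmega (sec42DataOf h iso (pkgF L) ι₁ (pkgV V) Φ))
    (Car : Def45.Carriers L μ) (Dμ : ObjOne (AlgHom.id ℚ (L : Type)) ι₁ hμ hw Car) (τ' : L →+* ℂ) (hτ' : τ' ∈ hμ.cmType.1)
    (i : Char) (hadmμ : ∀ d : LiuCMSide, d.IsReflexOfTypeG ((starRingEnd ℂ).comp ι₁) hμ.cmType → adm i d) :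
    ∃ (M : (toThm418Data (sec42DataOf h iso (pkgF L) ι₁ (pkgV V) Φ)
          (U.rest (restTailOne (AlgHom.id ℚ (L : Type)) ι₁ hμ hw Car
            ((sec42DataOf_heckeTranslates hU7 h (pkgV V) Φ iso h4).rhoΩOne (AlgHom.id ℚ (L : Type)) ι₁ hμ hw Car)))).Map43RationalData)
      (jH : M.HB →ₗ[ℂ] (LiuDictionary.ofTower hHD hI h₁ h₃ hA V Char Adm Ω PhiMu adm).H),
      Function.Injective jH ∧
      (∀ (g : ↥V.adelicFin) (x : M.HB), jH (M.ρB g x) = MonoidAlgebra.of ℂ ↥V.adelicFin g • jH x) ∧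
      ∀ K : HodgeCM.Level V,
        K ≤ Level.capThree (V := V) ((sec42DataOf h iso (pkgF L) ι₁ (pkgV V) Φ).S.K₀.1 : Subgroup ↥V.adelicFin)
          (sec42DataOf h iso (pkgF L) ι₁ (pkgV V) Φ).S.K₀.2.1 →
        Nonempty (HcmPieces.{0, 1, 0}
          (toThm418Data (sec42DataOf h iso (pkgF L) ι₁ (pkgV V) Φ)
            (U.rest (restTailOne (AlgHom.id ℚ (L : Type)) ι₁ hμ hw Car
              ((sec42DataOf_heckeTranslates hU7 h (pkgV V) Φ iso h4).rhoΩOne (AlgHom.id ℚ (L : Type)) ι₁ hμ hw Car))))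
          M (LiuDictionary.ofTower hHD hI h₁ h₃ hA V Char Adm Ω PhiMu adm).H jH K.K
          ((picardCMUniverse hHD hI h₁ h₃).CohC ((picardCMUniverse hHD hI h₁ h₃).pms L ι₁ V K) 1)
          (resTotal hHD hI (ballQuotientUniformisedDatum_of h₁) h₃ hA K)
          ((LiuDictionary.ofTower hHD hI h₁ h₃ hA V Char Adm Ω PhiMu adm).cmClasses K i)) := by
  letI : Algebra (L : Type) ℂ := ((starRingEnd ℂ).comp ι₁).toAlgebra
  have hinst : ∀ x : L, algebraMap (L : Type) ℂ x = ((starRingEnd ℂ).comp ι₁) x := fun _ => rfl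
  have hι : (algebraMap (L : Type) ℂ).comp (cmConjRingHom L) = ι₁ := by
    ext x
    rw [RingHom.coe_comp, Function.comp_apply, hinst, embedding_cmConjRingHom, RingHom.coe_comp, Function.comp_apply,
      starRingEnd_self_apply]
  refine ⟨map43RecordAtPin (componentAlbanesePinTotal hHD hI (ballQuotientUniformisedDatum_of h₁) h₃ hA hU7 V h h4 hι Φ iso)
      (AlgHom.id ℚ (L : Type)) ι₁ hμ hw Car U.Eps U.epsOf U.Chi (U.omega μ hμ) (U.rho μ hμ) Dμ τ' hτ',
    jHPin (componentAlbanesePinTotal hHD hI (ballQuotientUniformisedDatum_of h₁) h₃ hA hU7 V h h4 hι Φ iso)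
      (AlgHom.id ℚ (L : Type)) ι₁ hμ hw Car U.Eps U.epsOf U.Chi (U.omega μ hμ) (U.rho μ hμ) Dμ τ' hτ',
    jHPin_injective (componentAlbanesePinTotal hHD hI (ballQuotientUniformisedDatum_of h₁) h₃ hA hU7 V h h4 hι Φ iso)
      (AlgHom.id ℚ (L : Type)) ι₁ hμ hw Car U.Eps U.epsOf U.Chi (U.omega μ hμ) (U.rho μ hμ) Dμ τ' hτ',
    jHPin_comm (componentAlbanesePinTotal hHD hI (ballQuotientUniformisedDatum_of h₁) h₃ hA hU7 V h h4 hι Φ iso)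
      (AlgHom.id ℚ (L : Type)) ι₁ hμ hw Car U.Eps U.epsOf U.Chi (U.omega μ hμ) (U.rho μ hμ) Dμ τ' hτ',
    fun K hK => ?_⟩
  -- the (d) half at the shared `ι₁`-presented tail under the instance `ῑ₁` (d2bridge-wb-3, ✔ `HcmPiecesAtPinConjInst`)
  exact nonempty_hcmPieces_atUniformRest_conjInst Char Adm Ω PhiMu adm hμ hw Car h (sec42DataOf h iso (pkgF L) ι₁ (pkgV V) Φ)
    (sec42DataOf_heckeTranslates hU7 h (pkgV V) Φ iso h4) hinst U
    (componentAlbanesePinTotal hHD hI (ballQuotientUniformisedDatum_of h₁) h₃ hA hU7 V h h4 hι Φ iso)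
    (componentAlbanesePinTotal_levelLaw hHD hI (ballQuotientUniformisedDatum_of h₁) h₃ hA hU7 V h h4 hι Φ iso) Dμ τ' hτ' i K hK hadmμ

set_option synthInstance.maxHeartbeats 400000 in
set_option maxHeartbeats 3200000 in
/-- **THE PLUG with `Dμ` discharged by the END's cite `h21`** ([Shimura1998] Thm. 21.4 ⟹ [Liu2021] Prop. 4.6 (1) «`𝒜(μ) ≠ ∅`», ✔
`Def45.nonempty_cmDatum_polDR_rMuForm_of_casselman`), at the carrier of record `ofPolDR μ (PolDR ι₁ hμ (RMuForm ι₁ hμ))` — the END's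
tail `𝔱⟦μ⟧` exactly — and Liu's auxiliary `τ' ∈ Φ_μ` («fix an element `τ′ ∈ Φ_μ`», proof of Thm. 4.18 l. 2250) CHOSEN INSIDE the proof
(a CM type contains one of `ι₁`, `ῑ₁`).  Remaining input: the key implication `hadmμ` (at the re-keyed pin: `fun d hd => hΦμ ▸ hd`).
HC_CM is NOT proved; «Δ2 BRIDGE CLOSED» is NOT claimed.
[cite: Liu2021, Prop. 4.6 (1) (FJcycle.tex l. 1969) with its proof (l. 1975–1984), Thm. 4.18 (1) (l. 2239), proof of Thm. 4.18 (l. 2247–2253)] [cite: Shimura1998, §21.4 Thm. 21.4] -/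
theorem exists_jRecord_pieces_conj_of_casselman (hHD : exists_isReal_hodgeModel) (hI : hodgePQ_independent_of_hodgeModel)
    (h₁ : BallQuotientUniformised) (h₃ : CMAbelianVarietyRealised) (hA : Arapura2012_Cor_15_4_6)
    (hU7 : heckeTranslate_definedOver) {h : exists_recordSystem} (h4 : 4 ≤ Module.finrank ℚ (L : Type))
    (Φ : Literature.AlgebraicGeometry.Motives.CMType L)
    (iso : ∀ (F : Summit.HodgeConjecture.CorCM.CMField) (ι : F →+* ℂ) (_ : Summit.HodgeConjecture.CorCM.HermSpace3 F ι)
      (_ : Literature.AlgebraicGeometry.Motives.CMType F), ℕ → Prop)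
    (U : UniformOmega (sec42DataOf h iso (pkgF L) ι₁ (pkgV V) Φ))
    (h21 : shimura1998_thm21_4_casselman)
    (i : Char) (hadmμ : ∀ d : LiuCMSide, d.IsReflexOfTypeG ((starRingEnd ℂ).comp ι₁) hμ.cmType → adm i d) :
    ∃ (M : (toThm418Data (sec42DataOf h iso (pkgF L) ι₁ (pkgV V) Φ)
          (U.rest (restTailOne (AlgHom.id ℚ (L : Type)) ι₁ hμ hw
            (Def45.Carriers.ofPolDR μ (Def45.PolDR ι₁ hμ (Def45.RMuForm ι₁ hμ)))
            ((sec42DataOf_heckeTranslates hU7 h (pkgV V) Φ iso h4).rhoΩOne (AlgHom.id ℚ (L : Type)) ι₁ hμ hw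
              (Def45.Carriers.ofPolDR μ (Def45.PolDR ι₁ hμ (Def45.RMuForm ι₁ hμ))))))).Map43RationalData)
      (jH : M.HB →ₗ[ℂ] (LiuDictionary.ofTower hHD hI h₁ h₃ hA V Char Adm Ω PhiMu adm).H),
      Function.Injective jH ∧
      (∀ (g : ↥V.adelicFin) (x : M.HB), jH (M.ρB g x) = MonoidAlgebra.of ℂ ↥V.adelicFin g • jH x) ∧
      ∀ K : HodgeCM.Level V,
        K ≤ Level.capThree (V := V) ((sec42DataOf h iso (pkgF L) ι₁ (pkgV V) Φ).S.K₀.1 : Subgroup ↥V.adelicFin)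
          (sec42DataOf h iso (pkgF L) ι₁ (pkgV V) Φ).S.K₀.2.1 →
        Nonempty (HcmPieces.{0, 1, 0}
          (toThm418Data (sec42DataOf h iso (pkgF L) ι₁ (pkgV V) Φ)
            (U.rest (restTailOne (AlgHom.id ℚ (L : Type)) ι₁ hμ hw
              (Def45.Carriers.ofPolDR μ (Def45.PolDR ι₁ hμ (Def45.RMuForm ι₁ hμ)))
              ((sec42DataOf_heckeTranslates hU7 h (pkgV V) Φ iso h4).rhoΩOne (AlgHom.id ℚ (L : Type)) ι₁ hμ hw
                (Def45.Carriers.ofPolDR μ (Def45.PolDR ι₁ hμ (Def45.RMuForm ι₁ hμ)))))))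
          M (LiuDictionary.ofTower hHD hI h₁ h₃ hA V Char Adm Ω PhiMu adm).H jH K.K
          ((picardCMUniverse hHD hI h₁ h₃).CohC ((picardCMUniverse hHD hI h₁ h₃).pms L ι₁ V K) 1)
          (resTotal hHD hI (ballQuotientUniformisedDatum_of h₁) h₃ hA K)
          ((LiuDictionary.ofTower hHD hI h₁ h₃ hA V Char Adm Ω PhiMu adm).cmClasses K i)) := by
  -- Liu's «fix an element `τ′ ∈ Φ_μ`»: a CM type contains exactly one of `ι₁`, `conj ∘ ι₁`
  obtain ⟨τ', hτ'⟩ : ∃ τ' : L →+* ℂ, τ' ∈ hμ.cmType.1 := by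
    by_cases hι₁ : ι₁ ∈ hμ.cmType.1
    · exact ⟨ι₁, hι₁⟩
    · exact ⟨_, not_not.mp (mt (hμ.cmType.2 ι₁).mpr hι₁)⟩
  exact exists_jRecord_pieces_conj V Char Adm Ω PhiMu adm hμ hw hHD hI h₁ h₃ hA hU7 h4 Φ iso U
    (Def45.Carriers.ofPolDR μ (Def45.PolDR ι₁ hμ (Def45.RMuForm ι₁ hμ)))
    ⟨Def45.nonempty_cmDatum_polDR_rMuForm_of_casselman ι₁ hμ hw h21⟩ τ' hτ' i hadmμ

end Plug

/-! ## §2  At the RE-KEYED literal pin (the END′'s slots): `Char := I`, `Adm i := {χ ∕∕ IsAutChar χ}`, `PhiMu′ ∕ adm′` read at `ῑ₁` -/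

section RekeyedPin

open HodgeCM.Literature.Theta.LiuAlbaneseModuleDatum.D2Bridge (HcmPieces)
open Summit.HodgeConjecture.CorCM.Model (heckeTranslatesFamilyOf)

variable {L : HodgeCM.CMField} [IsGalois ℚ (L : Type)] {ι₁ : L →+* ℂ}
variable {μ : Literature.NumberTheory.Automorphic.IdeleClassGroup L →ₜ* Circle}

set_option synthInstance.maxHeartbeats 400000 in
set_option maxHeartbeats 3200000 in
/-- **(c)+(d) BY VALUE AT THE RE-KEYED LITERAL PIN — the END′'s five residual binders `M ∕ jH ∕ hjHinj ∕ hjH ∕ pieces` at one served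
character, from its own displayed rows.**  The dictionary is `HodgeCM.Model.Rekey.liuDictionaryPin hHD hI h₁ h₃ hA V I line` WRITTEN OUT
(`LiuDictionary.ofTower … I (fun i => {χ ∕∕ (line i).IsAutChar χ}) (fun i a => (line i).Ω (ιVE V) a.1) (fun i => PhiMuLine ῑ₁ (line i))
(fun i dd => dd.IsReflexOfTypeG ῑ₁ (typeOfLine (line i)))` — the L0′ module is a chain of `abbrev`s over exactly this term, so the END′'s
slot types unify with these by unfolding); the tail is the END's `restTailOne (AlgHom.id ℚ L) ι₁ hμ hw (ofPolDR μ (PolDR ι₁ hμ (RMuForm ι₁ hμ)))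
((heckeTranslatesFamilyOf hU7 h iso (pkgF L) ι₁ (pkgV V) Φ h6).rhoΩOne …)` VERBATIM.  Inputs: the END's rows `hU7 ∕ h ∕ h6 ∕ h21`, its
`U := 𝕌 i`, and per character `hΦμ : HasCMType L μ (line i).lineType` (the END's (c)(d) key, referee F2) — under which S1's output
`IsReflexOfTypeG ῑ₁ Φ_μ` IS `adm′ i` (`HasCMType.unique`, T-SIGN = MIRROR).  CONSUMER RECIPE (END′ §B ∕ §A′): `choose M jH hjHinj hjH hP
using fun i μ hμ hw hΦμ => exists_jRecord_pieces_rekeyedPin …`, `pieces := fun … K hK => Classical.choice (hP … K hK)`.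
HC_CM is NOT proved; «Δ2 BRIDGE CLOSED» is NOT claimed; nothing here is a display or a pointer move.
[cite: Liu2021, Thm. 4.18 (1) (FJcycle.tex l. 2239), proof of Thm. 4.18 (l. 2247–2253: «fix τ′ ∈ Φ_μ»), Def. 4.3 (2) (l. 1919), Def. 4.5 (2) (l. 1944–1951), Def. 4.11 (l. 2083–2101), Lem. 2.4 (1) (l. 1210–1228), Prop. 4.6 (1) (l. 1969)] [cite: Shimura1998, §21.4 Thm. 21.4] -/
theorem exists_jRecord_pieces_rekeyedPin (hHD : exists_isReal_hodgeModel) (hI : hodgePQ_independent_of_hodgeModel)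
    (h₁ : BallQuotientUniformised) (h₃ : CMAbelianVarietyRealised) (hA : Arapura2012_Cor_15_4_6)
    (hU7 : heckeTranslate_definedOver) {h : exists_recordSystem} (V : HodgeCM.HermSpace3 L ι₁) (h6 : 6 ≤ Module.finrank ℚ (L : Type))
    (Φ : Literature.AlgebraicGeometry.Motives.CMType L)
    (iso : ∀ (F : Summit.HodgeConjecture.CorCM.CMField) (ι : F →+* ℂ) (_ : Summit.HodgeConjecture.CorCM.HermSpace3 F ι)
      (_ : Literature.AlgebraicGeometry.Motives.CMType F), ℕ → Prop)
    (I : Type) (line : I → HodgeCM.Model.SplitLineE V) (i : I)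
    (U : UniformOmega (sec42DataOf h iso (pkgF L) ι₁ (pkgV V) Φ)) (h21 : shimura1998_thm21_4_casselman)
    (hμ : Literature.NumberTheory.Automorphic.IdeleClassGroup.IsConjugateSymplectic L μ)
    (hw : Literature.NumberTheory.Automorphic.IdeleClassGroup.HasWeight L μ 1)
    (hΦμ : Literature.NumberTheory.Automorphic.IdeleClassGroup.HasCMType L μ (line i).lineType) :
    ∃ (M : (toThm418Data (sec42DataOf h iso (pkgF L) ι₁ (pkgV V) Φ)
          (U.rest (restTailOne (AlgHom.id ℚ (L : Type)) ι₁ hμ hw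
            (Def45.Carriers.ofPolDR μ (Def45.PolDR ι₁ hμ (Def45.RMuForm ι₁ hμ)))
            ((heckeTranslatesFamilyOf hU7 h iso (pkgF L) ι₁ (pkgV V) Φ h6).rhoΩOne (AlgHom.id ℚ (L : Type)) ι₁ hμ hw
              (Def45.Carriers.ofPolDR μ (Def45.PolDR ι₁ hμ (Def45.RMuForm ι₁ hμ))))))).Map43RationalData)
      (jH : M.HB →ₗ[ℂ] (LiuDictionary.ofTower hHD hI h₁ h₃ hA V I (fun i => {χ : (line i).CharW // (line i).IsAutChar χ})
          (fun i a => (line i).Ω (HodgeCM.Model.ιVE V) a.1)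
          (fun i => HodgeCM.Model.SplitLine.PhiMuLine ((starRingEnd ℂ).comp ι₁) (line i))
          (fun i dd => dd.IsReflexOfTypeG ((starRingEnd ℂ).comp ι₁) (HodgeCM.Model.SplitLine.typeOfLine (line i)))).H),
      Function.Injective jH ∧
      (∀ (g : ↥V.adelicFin) (x : M.HB), jH (M.ρB g x) = MonoidAlgebra.of ℂ ↥V.adelicFin g • jH x) ∧
      ∀ K : HodgeCM.Level V,
        K ≤ Level.capThree (V := V) ((sec42DataOf h iso (pkgF L) ι₁ (pkgV V) Φ).S.K₀.1 : Subgroup ↥V.adelicFin)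
          (sec42DataOf h iso (pkgF L) ι₁ (pkgV V) Φ).S.K₀.2.1 →
        Nonempty (HcmPieces.{0, 1, 0}
          (toThm418Data (sec42DataOf h iso (pkgF L) ι₁ (pkgV V) Φ)
            (U.rest (restTailOne (AlgHom.id ℚ (L : Type)) ι₁ hμ hw
              (Def45.Carriers.ofPolDR μ (Def45.PolDR ι₁ hμ (Def45.RMuForm ι₁ hμ)))
              ((heckeTranslatesFamilyOf hU7 h iso (pkgF L) ι₁ (pkgV V) Φ h6).rhoΩOne (AlgHom.id ℚ (L : Type)) ι₁ hμ hw
                (Def45.Carriers.ofPolDR μ (Def45.PolDR ι₁ hμ (Def45.RMuForm ι₁ hμ)))))))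
          M
          (LiuDictionary.ofTower hHD hI h₁ h₃ hA V I (fun i => {χ : (line i).CharW // (line i).IsAutChar χ})
            (fun i a => (line i).Ω (HodgeCM.Model.ιVE V) a.1)
            (fun i => HodgeCM.Model.SplitLine.PhiMuLine ((starRingEnd ℂ).comp ι₁) (line i))
            (fun i dd => dd.IsReflexOfTypeG ((starRingEnd ℂ).comp ι₁) (HodgeCM.Model.SplitLine.typeOfLine (line i)))).H jH K.K
          ((picardCMUniverse hHD hI h₁ h₃).CohC ((picardCMUniverse hHD hI h₁ h₃).pms L ι₁ V K) 1)
          (resTotal hHD hI (ballQuotientUniformisedDatum_of h₁) h₃ hA K)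
          ((LiuDictionary.ofTower hHD hI h₁ h₃ hA V I (fun i => {χ : (line i).CharW // (line i).IsAutChar χ})
            (fun i a => (line i).Ω (HodgeCM.Model.ιVE V) a.1)
            (fun i => HodgeCM.Model.SplitLine.PhiMuLine ((starRingEnd ℂ).comp ι₁) (line i))
            (fun i dd => dd.IsReflexOfTypeG ((starRingEnd ℂ).comp ι₁) (HodgeCM.Model.SplitLine.typeOfLine (line i)))).cmClasses K i)) := by
  have hΦ : hμ.cmType = HodgeCM.Model.SplitLine.typeOfLine (line i) :=
    Literature.NumberTheory.Automorphic.IdeleClassGroup.HasCMType.unique hμ.hasCMType_cmType hΦμ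
  exact exists_jRecord_pieces_conj_of_casselman V I (fun i => {χ : (line i).CharW // (line i).IsAutChar χ})
    (fun i a => (line i).Ω (HodgeCM.Model.ιVE V) a.1)
    (fun i => HodgeCM.Model.SplitLine.PhiMuLine ((starRingEnd ℂ).comp ι₁) (line i))
    (fun i dd => dd.IsReflexOfTypeG ((starRingEnd ℂ).comp ι₁) (HodgeCM.Model.SplitLine.typeOfLine (line i)))
    hμ hw hHD hI h₁ h₃ hA hU7 (le_trans (by norm_num) h6) Φ iso U h21 i (fun d hd => hΦ ▸ hd)

/-! ## §3  At the LITERAL (live) pin — the END edition 2's five (c)(d) families reduce to ONE admissibility transport per character -/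

set_option synthInstance.maxHeartbeats 400000 in
set_option maxHeartbeats 3200000 in
/-- **THE (c)(d) RESIDUAL OF THE LIVE-PIN END, ISOLATED.**  At the LITERAL pinned dictionary `HodgeCM.Model.liuDictionaryPin hHD hI h₁ h₃ hA V I line`
(written out: `PhiMu i := PhiMuLine ι₁ (line i)`, `adm i d := d.IsReflexOfTypeG ι₁ (typeOfLine (line i))` — `abbrev` chain over
`LiuDictionary.ofTower`), the five families `M ∕ jH ∕ hjHinj ∕ hjH ∕ pieces` that `CorCM/PortJoin/ClosedPrinted.lean` displays BY NAME are
inhabited — from the END's own rows `hU7 ∕ h ∕ h6 ∕ h21` and the tree's variety-side supply (J2 cofan along `ῑ₁`, S1 through `ῑ₁`) — AS SOON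
AS the one implication `hadm : ∀ d, d.IsReflexOfTypeG ῑ₁ Φ_μ → d.IsReflexOfTypeG ι₁ (typeOfLine (line i))` holds at the character: the
variety side delivers `ῑ₁`-reflex records, the literal key asks `ι₁`-reflex ones.  This implication is exactly the orientation datum of
ORIENTATION-MEMO §0∕§8 (for `L/ℚ` Galois and `ι₁ ∈ Φ_μ` it is REFUTED by ✔ `OrientationReflexConj.not_forall_isReflexOfTypeG_starRingEnd_comp_imp`;
under T-SIGN = MIRROR, `Φ_μ = typeOfLine (line i)`, it is the re-key §2 dispenses with).  Nothing is asserted about it here; the theorem only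
LOCATES the live-pin residual in one Prop per served character.  HC_CM is NOT proved; «Δ2 BRIDGE CLOSED» is NOT claimed.
[cite: Liu2021, Thm. 4.18 (1) (FJcycle.tex l. 2239), proof of Thm. 4.18 (l. 2247–2253), Def. 4.3 (2) (l. 1919), Rem. 4.4 (l. 1930–1933), Def. 4.5 (2) (l. 1944–1951), Prop. 4.6 (1) (l. 1969)] [cite: Shimura1998, §21.4 Thm. 21.4] -/
theorem exists_jRecord_pieces_livePin_of_admTransport (hHD : exists_isReal_hodgeModel) (hI : hodgePQ_independent_of_hodgeModel)
    (h₁ : BallQuotientUniformised) (h₃ : CMAbelianVarietyRealised) (hA : Arapura2012_Cor_15_4_6)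
    (hU7 : heckeTranslate_definedOver) {h : exists_recordSystem} (V : HodgeCM.HermSpace3 L ι₁) (h6 : 6 ≤ Module.finrank ℚ (L : Type))
    (Φ : Literature.AlgebraicGeometry.Motives.CMType L)
    (iso : ∀ (F : Summit.HodgeConjecture.CorCM.CMField) (ι : F →+* ℂ) (_ : Summit.HodgeConjecture.CorCM.HermSpace3 F ι)
      (_ : Literature.AlgebraicGeometry.Motives.CMType F), ℕ → Prop)
    (I : Type) (line : I → HodgeCM.Model.SplitLineE V) (i : I)
    (U : UniformOmega (sec42DataOf h iso (pkgF L) ι₁ (pkgV V) Φ)) (h21 : shimura1998_thm21_4_casselman)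
    (hμ : Literature.NumberTheory.Automorphic.IdeleClassGroup.IsConjugateSymplectic L μ)
    (hw : Literature.NumberTheory.Automorphic.IdeleClassGroup.HasWeight L μ 1)
    (hadm : ∀ d : LiuCMSide, d.IsReflexOfTypeG ((starRingEnd ℂ).comp ι₁) hμ.cmType →
      d.IsReflexOfTypeG ι₁ (HodgeCM.Model.SplitLine.typeOfLine (line i))) :
    ∃ (M : (toThm418Data (sec42DataOf h iso (pkgF L) ι₁ (pkgV V) Φ)
          (U.rest (restTailOne (AlgHom.id ℚ (L : Type)) ι₁ hμ hw
            (Def45.Carriers.ofPolDR μ (Def45.PolDR ι₁ hμ (Def45.RMuForm ι₁ hμ)))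
            ((heckeTranslatesFamilyOf hU7 h iso (pkgF L) ι₁ (pkgV V) Φ h6).rhoΩOne (AlgHom.id ℚ (L : Type)) ι₁ hμ hw
              (Def45.Carriers.ofPolDR μ (Def45.PolDR ι₁ hμ (Def45.RMuForm ι₁ hμ))))))).Map43RationalData)
      (jH : M.HB →ₗ[ℂ] (LiuDictionary.ofTower hHD hI h₁ h₃ hA V I (fun i => {χ : (line i).CharW // (line i).IsAutChar χ})
          (fun i a => (line i).Ω (HodgeCM.Model.ιVE V) a.1)
          (fun i => HodgeCM.Model.SplitLine.PhiMuLine ι₁ (line i))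
          (fun i dd => dd.IsReflexOfTypeG ι₁ (HodgeCM.Model.SplitLine.typeOfLine (line i)))).H),
      Function.Injective jH ∧
      (∀ (g : ↥V.adelicFin) (x : M.HB), jH (M.ρB g x) = MonoidAlgebra.of ℂ ↥V.adelicFin g • jH x) ∧
      ∀ K : HodgeCM.Level V,
        K ≤ Level.capThree (V := V) ((sec42DataOf h iso (pkgF L) ι₁ (pkgV V) Φ).S.K₀.1 : Subgroup ↥V.adelicFin)
          (sec42DataOf h iso (pkgF L) ι₁ (pkgV V) Φ).S.K₀.2.1 →
        Nonempty (HcmPieces.{0, 1, 0}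
          (toThm418Data (sec42DataOf h iso (pkgF L) ι₁ (pkgV V) Φ)
            (U.rest (restTailOne (AlgHom.id ℚ (L : Type)) ι₁ hμ hw
              (Def45.Carriers.ofPolDR μ (Def45.PolDR ι₁ hμ (Def45.RMuForm ι₁ hμ)))
              ((heckeTranslatesFamilyOf hU7 h iso (pkgF L) ι₁ (pkgV V) Φ h6).rhoΩOne (AlgHom.id ℚ (L : Type)) ι₁ hμ hw
                (Def45.Carriers.ofPolDR μ (Def45.PolDR ι₁ hμ (Def45.RMuForm ι₁ hμ)))))))
          M
          (LiuDictionary.ofTower hHD hI h₁ h₃ hA V I (fun i => {χ : (line i).CharW // (line i).IsAutChar χ})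
            (fun i a => (line i).Ω (HodgeCM.Model.ιVE V) a.1)
            (fun i => HodgeCM.Model.SplitLine.PhiMuLine ι₁ (line i))
            (fun i dd => dd.IsReflexOfTypeG ι₁ (HodgeCM.Model.SplitLine.typeOfLine (line i)))).H jH K.K
          ((picardCMUniverse hHD hI h₁ h₃).CohC ((picardCMUniverse hHD hI h₁ h₃).pms L ι₁ V K) 1)
          (resTotal hHD hI (ballQuotientUniformisedDatum_of h₁) h₃ hA K)
          ((LiuDictionary.ofTower hHD hI h₁ h₃ hA V I (fun i => {χ : (line i).CharW // (line i).IsAutChar χ})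
            (fun i a => (line i).Ω (HodgeCM.Model.ιVE V) a.1)
            (fun i => HodgeCM.Model.SplitLine.PhiMuLine ι₁ (line i))
            (fun i dd => dd.IsReflexOfTypeG ι₁ (HodgeCM.Model.SplitLine.typeOfLine (line i)))).cmClasses K i)) :=
  exists_jRecord_pieces_conj_of_casselman V I (fun i => {χ : (line i).CharW // (line i).IsAutChar χ})
    (fun i a => (line i).Ω (HodgeCM.Model.ιVE V) a.1)
    (fun i => HodgeCM.Model.SplitLine.PhiMuLine ι₁ (line i))
    (fun i dd => dd.IsReflexOfTypeG ι₁ (HodgeCM.Model.SplitLine.typeOfLine (line i)))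
    hμ hw hHD hI h₁ h₃ hA hU7 (le_trans (by norm_num) h6) Φ iso U h21 i hadm

end RekeyedPin

end Summit.HodgeConjecture.CorCM.D2Bridge

end
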